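import Literature.NumberTheory.LFunctions.KeiperLiZeroSum
import Summits.RiemannHypothesis.RiemannHypothesis.Theorems.Splittings.LiCriterionProgressions
import Summits.RiemannHypothesis.Statement
import HarnessLib

/-!
# Li's criterion along arithmetic progressions, bounded-below form: `RH ⟺ (λ_{qk})_k bounded below` (any `q ≥ 1`)
# (cell `pub/rh-split`, seat `rh-split-li-finite` g2 — RAW FORM, zero `def`s; proposed as NEW
# `Theorems/Splittings/LiCriterionProgressionsBL.lean` next to typer-1's `LiCriterionProgressions.lean`)

HONEST LABEL: SPLITTING SEARCH over kernel-typed RH-EQUIVALENCES; nothing here bears on the truth of RH.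

**New kernel statement (Bombieri–Lagarias road, complementary to typer-1's Li road
`Splittings.riemannHypothesis_iff_keiperLiCoeff_mul_nonneg`).**  For every modulus `q ≥ 1` and every
constant `C`:

  `(∀ k ≥ 1, −C ≤ λ_{qk}) → RH`      (`riemannHypothesis_of_keiperLiCoeff_mul_bddBelow`),

hence `RH ↔ (λ_{qk})_k bounded below ↔ ∀ k > k₀, λ_{qk} ≥ −C` for every `q ≥ 1`, `k₀`, `C ≥ 0`: along every
progression `qℕ` the Li inequalities admit NO finite head and NO slack — the finite lens finds no conjunct
there either (g0 census V11 «subsequence / AP splits», then NOT ATTEMPTED, is now a THEOREM in its strongest,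
bounded-below form).  Equivalently: if RH fails then `liminf_k λ_{qk} = −∞` for EVERY `q ≥ 1`.

PROOF.  Put `z = 1 − 1/ρ` and reparametrise each non-trivial zero by `ρ' := (1 − z^q)⁻¹`, so that
`1 − 1/ρ' = z^q` and Li's sum for the family `(ρ', m)` at exponent `k` is `λ_{qk}` (zeros with `z^q = 1`
contribute `0` to every `λ_{qk}` and have `|z| = 1`, i.e. `Re ρ = 1/2`; they are dropped from the index set).
Bombieri–Lagarias' Theorem 1 (c)⇒(a) (tree `bombieriLagarias1999_theorem1_pos_of_bddBelow`) applies to the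
powered family once its convergence weight is summable; the estimate
`(1+|Re(1−ρ̄')|)/(1+|1−ρ̄'|)² ≤ 18 q² /(1+γ²)` (binomial remainder `|(1−u)^q − 1 + qu| ≤ q²|u|²(1+|u|)^q`
with `u = 1/ρ`) reduces this to `Σ m(ρ)/(1+γ²) < ∞` (tree `ZetaZeroSum.summable_zeroOrder_div_one_add_sq`).
The conclusion `Re ρ' ≥ 1/2 ⟺ |z^q| ≤ 1 ⟺ |z| ≤ 1 ⟺ Re ρ ≥ 1/2`, and the pairing `ρ ↦ 1 − ρ̄` gives RH.
(Li's road gives only the nonnegative form: Li's lemma needs `a_n ≥ 0`; sub-progressions remove heads, not slack.)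
-/

noncomputable section

-- D-0017: `Summit.<S>.<S>.…` is the designed namespace of a single-problem summit.
set_option linter.dupNamespace false

namespace Summit.RiemannHypothesis.RiemannHypothesis.Theorems.Splittings

open Filter Topology Complex
open scoped ComplexConjugate
open Literature.NumberTheory.LFunctions
open Literature.NumberTheory.LFunctions.BombieriLagarias
open Literature.NumberTheory.LFunctions.ZetaZeros

namespace LiProgressionBL

/-! ## §0 Elementary estimates -/

/-- Binomial remainder: `‖(1+w)^g − 1 − g w‖ ≤ g² ‖w‖² (1+‖w‖)^g`. -/
theorem norm_one_add_pow_sub_le (w : ℂ) (g : ℕ) :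
    ‖(1 + w) ^ g - 1 - g * w‖ ≤ (g : ℝ) ^ 2 * ‖w‖ ^ 2 * (1 + ‖w‖) ^ g := by
  induction g with
  | zero => simp
  | succ g ih =>
    have key : (1 + w) ^ (g + 1) - 1 - ((g + 1 : ℕ) : ℂ) * w
        = (1 + w) * ((1 + w) ^ g - 1 - (g : ℂ) * w) + (g : ℂ) * w ^ 2 := by
      push_cast; ring
    rw [key]
    have hx : 0 ≤ ‖w‖ := norm_nonneg _
    have h1w : ‖1 + w‖ ≤ 1 + ‖w‖ := (norm_add_le _ _).trans_eq (by rw [norm_one])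
    have hA : ‖(1 + w) * ((1 + w) ^ g - 1 - (g : ℂ) * w)‖
        ≤ (1 + ‖w‖) * ((g : ℝ) ^ 2 * ‖w‖ ^ 2 * (1 + ‖w‖) ^ g) := by
      rw [norm_mul]
      exact mul_le_mul h1w ih (norm_nonneg _) (by positivity)
    have hB : ‖(g : ℂ) * w ^ 2‖ = (g : ℝ) * ‖w‖ ^ 2 := by
      rw [norm_mul, norm_pow, Complex.norm_natCast]
    have hY : 0 ≤ ‖w‖ ^ 2 * (1 + ‖w‖) ^ (g + 1) := by positivity
    have hX : ‖w‖ ^ 2 ≤ ‖w‖ ^ 2 * (1 + ‖w‖) ^ (g + 1) :=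
      le_mul_of_one_le_right (by positivity) (one_le_pow₀ (by linarith))
    have hg0 : (0 : ℝ) ≤ g := Nat.cast_nonneg g
    calc ‖(1 + w) * ((1 + w) ^ g - 1 - (g : ℂ) * w) + (g : ℂ) * w ^ 2‖
        ≤ ‖(1 + w) * ((1 + w) ^ g - 1 - (g : ℂ) * w)‖ + ‖(g : ℂ) * w ^ 2‖ := norm_add_le _ _
      _ ≤ (1 + ‖w‖) * ((g : ℝ) ^ 2 * ‖w‖ ^ 2 * (1 + ‖w‖) ^ g) + (g : ℝ) * ‖w‖ ^ 2 := by
        rw [hB]; exact add_le_add hA le_rfl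
      _ = (g : ℝ) ^ 2 * (‖w‖ ^ 2 * (1 + ‖w‖) ^ (g + 1)) + (g : ℝ) * ‖w‖ ^ 2 := by ring
      _ ≤ (g : ℝ) ^ 2 * (‖w‖ ^ 2 * (1 + ‖w‖) ^ (g + 1))
            + (g : ℝ) * (‖w‖ ^ 2 * (1 + ‖w‖) ^ (g + 1)) :=
        add_le_add le_rfl (mul_le_mul_of_nonneg_left hX hg0)
      _ ≤ ((g + 1 : ℕ) : ℝ) ^ 2 * ‖w‖ ^ 2 * (1 + ‖w‖) ^ (g + 1) := by
        push_cast
        have : ((g : ℝ) + 1) ^ 2 * ‖w‖ ^ 2 * (1 + ‖w‖) ^ (g + 1)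
            = ((g : ℝ) ^ 2 * (‖w‖ ^ 2 * (1 + ‖w‖) ^ (g + 1))
                + (g : ℝ) * (‖w‖ ^ 2 * (1 + ‖w‖) ^ (g + 1)))
              + ((g : ℝ) + 1) * (‖w‖ ^ 2 * (1 + ‖w‖) ^ (g + 1)) := by ring
        rw [this]
        have := mul_nonneg (by linarith : (0 : ℝ) ≤ (g : ℝ) + 1) hY
        linarith

/-- `(1+x)^g ≤ 2` for `x ≥ 0` and `g·x ≤ 1/2` (via `1 + x ≤ eˣ` and `e^{1/2} ≤ 2`). -/
theorem one_add_pow_le_two {x : ℝ} (hx : 0 ≤ x) {g : ℕ} (h : (g : ℝ) * x ≤ 1 / 2) :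
    (1 + x) ^ g ≤ 2 := by
  have h1 : (1 + x) ^ g ≤ Real.exp ((g : ℝ) * x) := by
    rw [Real.exp_nat_mul]
    exact pow_le_pow_left₀ (by linarith) (by linarith [Real.add_one_le_exp x]) g
  have h2 : Real.exp ((g : ℝ) * x) ≤ Real.exp (1 / 2) := Real.exp_le_exp.2 h
  have h3 : Real.exp (1 / 2 : ℝ) ≤ 2 := by
    have he : Real.exp 1 < 2.7182818286 := Real.exp_one_lt_d9
    have hsq : Real.exp (1 / 2) * Real.exp (1 / 2) = Real.exp 1 := by rw [← Real.exp_add]; norm_num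
    nlinarith [Real.exp_pos (1 / 2 : ℝ)]
  linarith

/-- `‖1 − 1/ρ‖ ≤ 1 ↔ 1/2 ≤ Re ρ` for `ρ ≠ 0` (the disc `|1 − 1/ρ| ≤ 1` is the half-plane `Re ρ ≥ 1/2`). -/
theorem norm_one_sub_one_div_le_one_iff {ρ : ℂ} (h0 : ρ ≠ 0) :
    ‖1 - 1 / ρ‖ ≤ 1 ↔ 1 / 2 ≤ ρ.re := by
  have h : 1 - 1 / ρ = (ρ - 1) / ρ := by field_simp
  rw [h, norm_div, div_le_one (norm_pos_iff.2 h0),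
    ← sq_le_sq₀ (norm_nonneg _) (norm_nonneg _), Complex.sq_norm, Complex.sq_norm,
    Complex.normSq_apply, Complex.normSq_apply]
  simp only [sub_re, one_re, sub_im, one_im, sub_zero]
  constructor <;> intro h' <;> nlinarith

/-- `(1 + |Re w|)/(1 + ‖w‖)² ≤ 1`. -/
theorem ratio_le_one (w : ℂ) : (1 + |w.re|) / (1 + ‖w‖) ^ 2 ≤ 1 := by
  have h1 : |w.re| ≤ ‖w‖ := Complex.abs_re_le_norm w
  have h2 : 0 ≤ ‖w‖ := norm_nonneg w
  rw [div_le_one (by positivity)]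
  nlinarith

/-- For `D ≠ 0`: the Bombieri–Lagarias ratio of the reflected point `1 − conj D⁻¹` is at most
`2‖D‖² + |Re D|`. -/
theorem ratio_inv_le {D : ℂ} (hD : D ≠ 0) :
    (1 + |(1 - conj D⁻¹).re|) / (1 + ‖1 - conj D⁻¹‖) ^ 2 ≤ 2 * ‖D‖ ^ 2 + |D.re| := by
  have hDn : 0 < ‖D‖ := norm_pos_iff.2 hD
  have hDne : ‖D‖ ≠ 0 := hDn.ne'
  have hre : (D⁻¹).re = D.re / ‖D‖ ^ 2 := by rw [Complex.inv_re, Complex.normSq_eq_norm_sq]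
  have hnum : 1 + |(1 - conj D⁻¹).re| ≤ 2 + |D.re| / ‖D‖ ^ 2 := by
    have e : (1 - conj D⁻¹).re = 1 - D.re / ‖D‖ ^ 2 := by
      simp only [sub_re, one_re, Complex.conj_re, hre]
    rw [e]
    have h1 := abs_sub (1 : ℝ) (D.re / ‖D‖ ^ 2)
    rw [abs_one, abs_div, abs_of_pos (by positivity : (0 : ℝ) < ‖D‖ ^ 2)] at h1
    linarith
  have hden : ‖D‖⁻¹ ^ 2 ≤ (1 + ‖1 - conj D⁻¹‖) ^ 2 := by
    have h1 : ‖D‖⁻¹ ≤ 1 + ‖1 - conj D⁻¹‖ := by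
      have h := norm_sub_le (1 : ℂ) (1 - conj D⁻¹)
      rw [sub_sub_cancel, norm_one, Complex.norm_conj, norm_inv] at h
      exact h
    exact pow_le_pow_left₀ (by positivity) h1 2
  calc (1 + |(1 - conj D⁻¹).re|) / (1 + ‖1 - conj D⁻¹‖) ^ 2
      ≤ (2 + |D.re| / ‖D‖ ^ 2) / ‖D‖⁻¹ ^ 2 := div_le_div₀ (by positivity) hnum (by positivity) hden
    _ = 2 * ‖D‖ ^ 2 + |D.re| := by field_simp

/-! ## §1 The powered family -/

/-- The `q`-th power reparametrisation `ρ' := (1 − (1 − 1/ρ)^q)⁻¹` is designed so that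
`1 − 1/ρ' = (1 − 1/ρ)^q`. -/
theorem one_sub_one_div_powZero (q : ℕ) (ρ : ℂ) :
    1 - 1 / (1 - (1 - 1 / ρ) ^ q)⁻¹ = (1 - 1 / ρ) ^ q := by
  simp only [one_div, inv_inv, sub_sub_cancel]

/-- `ρ' ≠ 0` off the excluded set `(1 − 1/ρ)^q = 1`. -/
theorem powZero_ne_zero {q : ℕ} {ρ : ℂ} (h : (1 - 1 / ρ) ^ q ≠ 1) : (1 - (1 - 1 / ρ) ^ q)⁻¹ ≠ 0 :=
  inv_ne_zero (sub_ne_zero.2 (Ne.symm h))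

/-- `ρ' ≠ 1` (as `ρ ≠ 1`). -/
theorem powZero_ne_one {q : ℕ} {ρ : ℂ} (h1 : ρ ≠ 1) : (1 - (1 - 1 / ρ) ^ q)⁻¹ ≠ 1 := by
  intro h
  have h' : (1 - 1 / ρ) ^ q = 0 := by rw [← one_sub_one_div_powZero q ρ, h]; simp
  have h'' : 1 - 1 / ρ = 0 := (pow_eq_zero_iff'.1 h').1
  apply h1
  have : ρ⁻¹ = 1 := by rw [← one_div]; linear_combination -h''
  exact inv_eq_one.1 this

/-- Non-trivial zeros are `≠ 0`. -/
theorem coe_ne_zero (ρ : ZetaZeros.riemannZetaNontrivialZeros) : (ρ : ℂ) ≠ 0 := fun h ↦ by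
  have := riemannZetaNontrivialZeros.re_pos ρ.2
  simp [h] at this

/-- The multiplicity as a natural number. -/
theorem toNat_order_cast (ρ : ZetaZeros.riemannZetaNontrivialZeros) :
    (((riemannZetaZeroOrder (ρ : ℂ)).toNat : ℕ) : ℝ) = (riemannZetaZeroOrder (ρ : ℂ) : ℝ) := by
  have h := riemannZetaNontrivialZeros.one_le_order ρ.2
  have : ((riemannZetaZeroOrder (ρ : ℂ)).toNat : ℤ) = riemannZetaZeroOrder (ρ : ℂ) :=
    Int.toNat_of_nonneg (by omega)
  exact_mod_cast this

/-- **The weight estimate.** For a non-trivial zero `ρ = β + iγ` and `q ≥ 1`: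
`(1+|Re(1 − conj ρ')|)/(1+‖1 − conj ρ'‖)² ≤ 18 q²/(1+γ²)` with `ρ' = (1 − (1 − 1/ρ)^q)⁻¹`. -/
theorem ratio_powZero_le {q : ℕ} (hq : 1 ≤ q) (ρ : ZetaZeros.riemannZetaNontrivialZeros) :
    (1 + |(1 - conj (1 - (1 - 1 / (ρ : ℂ)) ^ q)⁻¹).re|) / (1 + ‖1 - conj (1 - (1 - 1 / (ρ : ℂ)) ^ q)⁻¹‖) ^ 2
      ≤ 18 * (q : ℝ) ^ 2 / (1 + (ρ : ℂ).im ^ 2) := by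
  have h0 := coe_ne_zero ρ
  have hβ0 := riemannZetaNontrivialZeros.re_pos ρ.2
  have hβ1 := riemannZetaNontrivialZeros.re_lt_one ρ.2
  have hq1 : (1 : ℝ) ≤ q := by exact_mod_cast hq
  have hρn : 0 < ‖(ρ : ℂ)‖ := norm_pos_iff.2 h0
  have him : (ρ : ℂ).im ^ 2 ≤ ‖(ρ : ℂ)‖ ^ 2 := by
    have := Complex.abs_im_le_norm (ρ : ℂ)
    rw [← sq_abs]
    exact pow_le_pow_left₀ (abs_nonneg _) this 2
  rcases lt_or_ge ‖(ρ : ℂ)‖ (3 * (q : ℝ)) with hsmall | hbig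
  · -- zeros of small modulus: the ratio is ≤ 1 ≤ 18 q²/(1+γ²)
    calc _ ≤ (1 : ℝ) := ratio_le_one _
      _ ≤ 18 * (q : ℝ) ^ 2 / (1 + (ρ : ℂ).im ^ 2) := by
        rw [le_div_iff₀ (by positivity), one_mul]
        have : ‖(ρ : ℂ)‖ ^ 2 < (3 * (q : ℝ)) ^ 2 := pow_lt_pow_left₀ hsmall hρn.le (by norm_num)
        nlinarith
  · -- zeros of large modulus: second-order expansion of `1 − (1 − u)^q`, `u = 1/ρ`
    set u : ℂ := 1 / (ρ : ℂ) with hu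
    set x : ℝ := ‖u‖ with hx
    have hxρ : x = ‖(ρ : ℂ)‖⁻¹ := by rw [hx, hu, norm_div, norm_one, one_div]
    have hx0 : 0 < x := by rw [hxρ]; positivity
    have hgx : (q : ℝ) * x ≤ 1 / 3 := by
      rw [hxρ, ← div_eq_mul_inv, div_le_iff₀ hρn]
      linarith
    set E : ℂ := (1 - u) ^ q - 1 + q * u with hE
    have hEle : ‖E‖ ≤ 2 * (q : ℝ) ^ 2 * x ^ 2 := by
      have h1 := norm_one_add_pow_sub_le (-u) q
      have e1 : (1 + -u) ^ q - 1 - (q : ℂ) * -u = E := by rw [hE]; ring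
      rw [e1, norm_neg] at h1
      have h2 : (1 + ‖u‖) ^ q ≤ 2 := one_add_pow_le_two (norm_nonneg _) (by rw [← hx]; linarith)
      calc ‖E‖ ≤ (q : ℝ) ^ 2 * ‖u‖ ^ 2 * (1 + ‖u‖) ^ q := h1
        _ ≤ (q : ℝ) ^ 2 * ‖u‖ ^ 2 * 2 := by gcongr
        _ = 2 * (q : ℝ) ^ 2 * x ^ 2 := by rw [hx]; ring
    set D : ℂ := 1 - (1 - u) ^ q with hD
    have hDE : D = q * u - E := by rw [hD, hE]; ring
    have hgu : ‖(q : ℂ) * u‖ = q * x := by rw [norm_mul, Complex.norm_natCast, hx]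
    have hDle : ‖D‖ ≤ 5 / 3 * (q * x) := by
      rw [hDE]
      calc ‖(q : ℂ) * u - E‖ ≤ ‖(q : ℂ) * u‖ + ‖E‖ := norm_sub_le _ _
        _ ≤ q * x + 2 * (q : ℝ) ^ 2 * x ^ 2 := by rw [hgu]; exact add_le_add le_rfl hEle
        _ ≤ 5 / 3 * (q * x) := by
          nlinarith [mul_le_mul_of_nonneg_left hgx (by positivity : (0 : ℝ) ≤ q * x)]
    have hDge : q * x / 3 ≤ ‖D‖ := by
      rw [hDE]
      have := norm_sub_norm_le ((q : ℂ) * u) E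
      rw [hgu] at this
      nlinarith [mul_le_mul_of_nonneg_left hgx (by positivity : (0 : ℝ) ≤ q * x)]
    have hDpos : 0 < ‖D‖ := lt_of_lt_of_le (by positivity) hDge
    have hD0 : D ≠ 0 := norm_pos_iff.1 hDpos
    have hure : |u.re| ≤ x ^ 2 := by
      have e : u.re = (ρ : ℂ).re / ‖(ρ : ℂ)‖ ^ 2 := by
        rw [hu, one_div, Complex.inv_re, Complex.normSq_eq_norm_sq]
      rw [e, abs_of_pos (div_pos hβ0 (by positivity)), hxρ, inv_pow, ← one_div]
      exact div_le_div_of_nonneg_right hβ1.le (by positivity)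
    have hDre : |D.re| ≤ 3 * (q : ℝ) ^ 2 * x ^ 2 := by
      rw [hDE, sub_re]
      have e1 : ((q : ℂ) * u).re = q * u.re := by simp [Complex.mul_re]
      rw [e1]
      have hEre : |E.re| ≤ ‖E‖ := Complex.abs_re_le_norm E
      calc |(q : ℝ) * u.re - E.re| ≤ |(q : ℝ) * u.re| + |E.re| := abs_sub _ _
        _ = q * |u.re| + |E.re| := by rw [abs_mul, abs_of_nonneg (by positivity : (0 : ℝ) ≤ q)]
        _ ≤ q * x ^ 2 + 2 * (q : ℝ) ^ 2 * x ^ 2 :=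
          add_le_add (mul_le_mul_of_nonneg_left hure (by positivity)) (hEre.trans hEle)
        _ ≤ 3 * (q : ℝ) ^ 2 * x ^ 2 := by
          nlinarith [mul_nonneg (mul_nonneg (by positivity : (0 : ℝ) ≤ q) (sub_nonneg.2 hq1))
            (sq_nonneg x)]
    have hρ3 : (3 : ℝ) ≤ ‖(ρ : ℂ)‖ := by linarith
    have hρsq : (1 : ℝ) ≤ ‖(ρ : ℂ)‖ ^ 2 := by nlinarith
    calc _ ≤ 2 * ‖D‖ ^ 2 + |D.re| := ratio_inv_le hD0
      _ ≤ 2 * (5 / 3 * (q * x)) ^ 2 + 3 * (q : ℝ) ^ 2 * x ^ 2 :=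
        add_le_add (mul_le_mul_of_nonneg_left (pow_le_pow_left₀ (norm_nonneg _) hDle 2) (by norm_num))
          hDre
      _ ≤ 9 * (q : ℝ) ^ 2 * x ^ 2 := by nlinarith
      _ = 9 * (q : ℝ) ^ 2 / ‖(ρ : ℂ)‖ ^ 2 := by rw [hxρ, inv_pow, div_eq_mul_inv]
      _ ≤ 18 * (q : ℝ) ^ 2 / (1 + (ρ : ℂ).im ^ 2) := by
        rw [div_le_div_iff₀ (by positivity) (by positivity)]
        have h9 : (0 : ℝ) ≤ 9 * (q : ℝ) ^ 2 := by positivity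
        nlinarith [mul_nonneg h9 (sub_nonneg.2 him), mul_nonneg h9 (sub_nonneg.2 hρsq)]

/-- **Bombieri–Lagarias' hypothesis for the powered family**: the reflected family `1 − conj ρ'` over the
good zeros has summable convergence weight (`≤ 18 q² Σ m(ρ)/(1+γ²)`). -/
theorem summable_weight_powZero {q : ℕ} (hq : 1 ≤ q) :
    Summable (weight
      (fun i : {ρ : ZetaZeros.riemannZetaNontrivialZeros | (1 - 1 / (ρ : ℂ)) ^ q ≠ 1} ↦
        1 - conj (1 - (1 - 1 / (i.1 : ℂ)) ^ q)⁻¹)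
      (fun i ↦ (riemannZetaZeroOrder (i.1 : ℂ)).toNat)) := by
  have hS : Summable fun ρ : ZetaZeros.riemannZetaNontrivialZeros ↦
      18 * (q : ℝ) ^ 2 * ((riemannZetaZeroOrder (ρ : ℂ) : ℝ) / (1 + (ρ : ℂ).im ^ 2)) :=
    ZetaZeroSum.summable_zeroOrder_div_one_add_sq.mul_left _
  refine Summable.of_nonneg_of_le (fun i ↦ weight_nonneg _ _ i) (fun i ↦ ?_) (hS.subtype
    {ρ : ZetaZeros.riemannZetaNontrivialZeros | (1 - 1 / (ρ : ℂ)) ^ q ≠ 1})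
  show weight _ _ i ≤ 18 * (q : ℝ) ^ 2 * ((riemannZetaZeroOrder (i.1 : ℂ) : ℝ) / (1 + (i.1 : ℂ).im ^ 2))
  unfold weight
  rw [toNat_order_cast]
  have hm0 : (0 : ℝ) ≤ riemannZetaZeroOrder (i.1 : ℂ) := by
    have := riemannZetaNontrivialZeros.one_le_order i.1.2
    exact_mod_cast (by omega : (0 : ℤ) ≤ riemannZetaZeroOrder (i.1 : ℂ))
  calc (riemannZetaZeroOrder (i.1 : ℂ) : ℝ)
        * ((1 + |(1 - conj (1 - (1 - 1 / (i.1 : ℂ)) ^ q)⁻¹).re|)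
          / (1 + ‖1 - conj (1 - (1 - 1 / (i.1 : ℂ)) ^ q)⁻¹‖) ^ 2)
      ≤ (riemannZetaZeroOrder (i.1 : ℂ) : ℝ) * (18 * (q : ℝ) ^ 2 / (1 + (i.1 : ℂ).im ^ 2)) :=
        mul_le_mul_of_nonneg_left (ratio_powZero_le hq i.1) hm0
    _ = _ := by ring

/-- **Li's sums of the powered family are the Li coefficients along `qℕ`**:
`Σ'_{good ρ} m(ρ) Re[1 − (1 − 1/ρ')^k] = λ_{qk}` (`k ≥ 1`). -/
theorem tsum_powZero_eq {q k : ℕ} (hq : 1 ≤ q) (hk : 1 ≤ k) :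
    ∑' i : {ρ : ZetaZeros.riemannZetaNontrivialZeros | (1 - 1 / (ρ : ℂ)) ^ q ≠ 1},
      (((riemannZetaZeroOrder (i.1 : ℂ)).toNat : ℕ) : ℝ)
        * (1 - (1 - 1 / (1 - (1 - 1 / (i.1 : ℂ)) ^ q)⁻¹) ^ k).re = keiperLiCoeff (q * k) := by
  have hqk : 1 ≤ q * k := Nat.one_le_iff_ne_zero.2 (Nat.mul_ne_zero (by omega) (by omega))
  rw [keiperLiCoeff_eq_tsum_zeros hqk]
  set f : ZetaZeros.riemannZetaNontrivialZeros → ℝ :=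
    fun ρ ↦ (riemannZetaZeroOrder (ρ : ℂ) : ℝ) * (1 - (1 - 1 / (ρ : ℂ)) ^ (q * k)).re with hf
  have h1 : ∀ i : {ρ : ZetaZeros.riemannZetaNontrivialZeros | (1 - 1 / (ρ : ℂ)) ^ q ≠ 1},
      (((riemannZetaZeroOrder (i.1 : ℂ)).toNat : ℕ) : ℝ)
        * (1 - (1 - 1 / (1 - (1 - 1 / (i.1 : ℂ)) ^ q)⁻¹) ^ k).re = f i.1 := by
    intro i
    rw [hf, toNat_order_cast, one_sub_one_div_powZero, ← pow_mul]
  rw [tsum_congr h1]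
  refine tsum_subtype_eq_of_support_subset
    (s := {ρ : ZetaZeros.riemannZetaNontrivialZeros | (1 - 1 / (ρ : ℂ)) ^ q ≠ 1}) ?_
  intro ρ hρ
  rw [Function.mem_support] at hρ
  simp only [Set.mem_setOf_eq]
  intro hz
  apply hρ
  show (riemannZetaZeroOrder (ρ : ℂ) : ℝ) * (1 - (1 - 1 / (ρ : ℂ)) ^ (q * k)).re = 0
  rw [pow_mul, hz, one_pow, sub_self, Complex.zero_re, mul_zero]

/-- `Re ρ ≥ 1/2` for every non-trivial zero ⇒ RH (pairing `ρ ↦ 1 − conj ρ`,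
tree `riemannZetaNontrivialZeros.one_sub_conj_mem`). -/
theorem riemannHypothesis_of_forall_half_le_re
    (h : ∀ ρ ∈ ZetaZeros.riemannZetaNontrivialZeros, 1 / 2 ≤ ρ.re) : _root_.RiemannHypothesis := by
  intro s hs htriv _
  have hmem : s ∈ ZetaZeros.riemannZetaNontrivialZeros := by
    refine ⟨hs, ?_⟩
    rintro ⟨k, hk⟩
    exact htriv ⟨k, hk.symm⟩
  have hge := h s hmem
  have hle := h (1 - conj s) (riemannZetaNontrivialZeros.one_sub_conj_mem hmem)
  simp only [sub_re, one_re, Complex.conj_re] at hle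
  linarith

end LiProgressionBL

open LiProgressionBL

/-! ## §2 The theorems (raw form: statements over tree declarations only) -/

/-- **Li along `qℕ`, bounded-below form (Bombieri–Lagarias (c)⇒(a) along a progression).**
If `λ_{qk} ≥ −C` for all `k ≥ 1` (some fixed `q ≥ 1`, `C`), then RH. -/
theorem riemannHypothesis_of_keiperLiCoeff_mul_bddBelow {q : ℕ} (hq : 1 ≤ q) {C : ℝ}
    (h : ∀ k : ℕ, 1 ≤ k → -C ≤ keiperLiCoeff (q * k)) : _root_.RiemannHypothesis := by
  have hq0 : q ≠ 0 := by omega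
  have hBL := bombieriLagarias1999_theorem1_pos_of_bddBelow
    (fun i : {ρ : ZetaZeros.riemannZetaNontrivialZeros | (1 - 1 / (ρ : ℂ)) ^ q ≠ 1} ↦
      (1 - (1 - 1 / (i.1 : ℂ)) ^ q)⁻¹)
    (fun i ↦ (riemannZetaZeroOrder (i.1 : ℂ)).toNat)
    (fun i ↦ by have := riemannZetaNontrivialZeros.one_le_order i.1.2; omega)
    (fun i ↦ powZero_ne_zero i.2)
    (fun i ↦ powZero_ne_one (riemannZetaNontrivialZeros.ne_one i.1.2))
    (summable_weight_powZero hq) (K := C) (fun k hk ↦ by rw [tsum_powZero_eq hq hk]; exact h k hk)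
  refine riemannHypothesis_of_forall_half_le_re fun ρ hρ ↦ ?_
  have h0 : ρ ≠ 0 := coe_ne_zero ⟨ρ, hρ⟩
  rw [← norm_one_sub_one_div_le_one_iff h0, ← pow_le_one_iff_of_nonneg (norm_nonneg _) hq0, ← norm_pow]
  by_cases hz : (1 - 1 / ρ) ^ q = 1
  · rw [hz, norm_one]
  · have h12 : 1 / 2 ≤ ((1 - (1 - 1 / ρ) ^ q)⁻¹).re := hBL ⟨⟨ρ, hρ⟩, hz⟩
    rwa [← one_sub_one_div_powZero q ρ, norm_one_sub_one_div_le_one_iff (powZero_ne_zero hz)]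

/-- **RH ⟺ the Li coefficients along `qℕ` are bounded below** (`q ≥ 1`). -/
theorem riemannHypothesis_iff_keiperLiCoeff_mul_bddBelow {q : ℕ} (hq : 1 ≤ q) :
    _root_.RiemannHypothesis ↔ ∃ C : ℝ, ∀ k : ℕ, 1 ≤ k → -C ≤ keiperLiCoeff (q * k) := by
  refine ⟨fun hRH ↦ ⟨0, fun k hk ↦ ?_⟩, fun ⟨C, h⟩ ↦ riemannHypothesis_of_keiperLiCoeff_mul_bddBelow hq h⟩
  rw [neg_zero]
  exact (riemannHypothesis_iff_keiperLiCoeff_mul_nonneg hq).1 hRH k hk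

/-- **Slack tail along a progression (finite lens: the relaxed co-finite AP tail is RH-complete).**
For `q ≥ 1`, any cut `k₀` and any slack `C`: `(∀ k > k₀, λ_{qk} ≥ −C) → RH`. -/
theorem riemannHypothesis_of_keiperLiCoeff_mul_slackTail {q : ℕ} (hq : 1 ≤ q) (k₀ : ℕ) {C : ℝ}
    (h : ∀ k : ℕ, k₀ < k → -C ≤ keiperLiCoeff (q * k)) : _root_.RiemannHypothesis := by
  classical
  -- bound the finitely many head terms by their own minimum
  set C' : ℝ := max C ((Finset.range (k₀ + 1)).sup' ⟨0, by simp⟩ fun k ↦ -keiperLiCoeff (q * k)) with hC'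
  refine riemannHypothesis_of_keiperLiCoeff_mul_bddBelow hq (C := C') fun k hk ↦ ?_
  rcases lt_or_ge k₀ k with hlt | hle
  · exact (neg_le_neg (le_max_left _ _)).trans (h k hlt)
  · have hmem : k ∈ Finset.range (k₀ + 1) := Finset.mem_range.2 (by omega)
    have : -keiperLiCoeff (q * k) ≤ C' :=
      (Finset.le_sup' (fun k ↦ -keiperLiCoeff (q * k)) hmem).trans (le_max_right _ _)
    linarith

/-- **RH ⟺ slack AP tail**, for every `q ≥ 1`, `k₀`, `C ≥ 0`. -/
theorem riemannHypothesis_iff_keiperLiCoeff_mul_slackTail {q : ℕ} (hq : 1 ≤ q) (k₀ : ℕ) {C : ℝ}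
    (hC : 0 ≤ C) :
    _root_.RiemannHypothesis ↔ ∀ k : ℕ, k₀ < k → -C ≤ keiperLiCoeff (q * k) := by
  refine ⟨fun hRH k hk ↦ ?_, riemannHypothesis_of_keiperLiCoeff_mul_slackTail hq k₀⟩
  have := (riemannHypothesis_iff_keiperLiCoeff_mul_nonneg hq).1 hRH k (by omega)
  linarith

/-- **Oscillation form**: if RH fails, then along EVERY progression `qℕ` the Li coefficients are unbounded
below: `∀ C, ∃ k ≥ 1, λ_{qk} < −C`. -/
theorem keiperLiCoeff_mul_unbounded_below_of_not_rh (hRH : ¬ _root_.RiemannHypothesis) {q : ℕ}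
    (hq : 1 ≤ q) (C : ℝ) : ∃ k : ℕ, 1 ≤ k ∧ keiperLiCoeff (q * k) < -C := by
  by_contra! h
  exact hRH (riemannHypothesis_of_keiperLiCoeff_mul_bddBelow hq h)

end Summit.RiemannHypothesis.RiemannHypothesis.Theorems.Splittings

end
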